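import Literature.NumberTheory.LFunctions.GRHTwistedCharacterPrimeSumsAverages
import HarnessLib

/-!
# Twisted prime sums under GRH, V: bookkeeping of the constants

Topic `Literature/NumberTheory/LFunctions`. THEOREMS (everything proved). Real-arithmetic
bookkeeping for `GRHTwistedPrimeSum.exists_norm_twistedPsi_le`
(`GRHTwistedCharacterPrimeSums.lean`): with `T = (q(|t| + 2)x)²`, `L = log(q(|t| + 2)x)`,
`ℓ = log x`, `s = √x` and `x ≥ 16`,

* `pointwiseBound_le` — the bound of `GRHTwistedPrimeSum.norm_twistedSum_add_zeroSums_le` at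
  `X ≤ 2x`, `c ≥ 2` is `≤ (12K + 6)ℓ + 32KL` (the factor `|t|` of the remainder is killed by
  `x L/T ≤ 1/4`, `|t| x L/T ≤ 1/2`);
* `windowLog_le` — the window factor `log q + log(2|t| + T + 5) ≤ 4L`;
* `norm_twistedPsi_arith` — everything is `≤ (6K + 73C₂ + 50) s ℓ L`.

## References

* H. L. Montgomery, R. C. Vaughan, *Multiplicative Number Theory I. Classical Theory*, CUP 2007,
  §13.1, proof of Theorem 13.7. [MontgomeryVaughan2007]
-/

noncomputable section

open Complex Filter Topology Set MeasureTheory intervalIntegral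
open scoped Real

namespace Literature.NumberTheory.LFunctions

namespace GRHTwistedPrimeSum

/-! ### Bookkeeping -/

/-- Sizes of `T = (q(|t| + 2)x)²` for `q ≥ 2`, `x ≥ 16`: with `R = q(|t| + 2)x`,
`64 ≤ R`, `4x ≤ R`, `2|t|x ≤ R`, `2 ≤ T`, `2|t| + T + 5 ≤ 2T`, `√T = R`. [folklore] -/
theorem T_facts {q t x : ℝ} (hq : 2 ≤ q) (hx : 16 ≤ x) :
    64 ≤ q * (|t| + 2) * x ∧ 4 * x ≤ q * (|t| + 2) * x ∧ 2 * |t| * x ≤ q * (|t| + 2) * x ∧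
      2 ≤ (q * (|t| + 2) * x) ^ 2 ∧
      2 * |t| + (q * (|t| + 2) * x) ^ 2 + 5 ≤ 2 * (q * (|t| + 2) * x) ^ 2 ∧
      Real.sqrt ((q * (|t| + 2) * x) ^ 2) = q * (|t| + 2) * x := by
  have ht : 0 ≤ |t| := abs_nonneg t
  have hx0 : 0 ≤ x := by linarith
  have h1 : 2 * (|t| + 2) ≤ q * (|t| + 2) := mul_le_mul_of_nonneg_right hq (by linarith)
  have h2 : q * (|t| + 2) * 16 ≤ q * (|t| + 2) * x :=
    mul_le_mul_of_nonneg_left hx (by nlinarith)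
  have hR : 32 * |t| + 64 ≤ q * (|t| + 2) * x := by nlinarith
  have hR64 : 64 ≤ q * (|t| + 2) * x := by linarith
  have h4x : 4 * x ≤ q * (|t| + 2) * x := mul_le_mul_of_nonneg_right (by nlinarith) hx0
  have htx : 2 * |t| * x ≤ q * (|t| + 2) * x := mul_le_mul_of_nonneg_right (by nlinarith) hx0
  refine ⟨hR64, h4x, htx, by nlinarith, by nlinarith, Real.sqrt_sq (by linarith)⟩

/-- `log 16 ≥ 2.77`, so `log x ≥ 2` and `log 2x ≤ 2 log x` for `x ≥ 16`; and
`√x ≥ 4`. [folklore] -/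
theorem log_facts {x : ℝ} (hx : 16 ≤ x) :
    4 ≤ Real.sqrt x ∧ 2.77 ≤ Real.log x ∧ Real.log (2 * x) ≤ 2 * Real.log x ∧
      Real.log (Real.sqrt x) = Real.log x / 2 := by
  have hx0 : 0 < x := by linarith
  have h2 : (0.6931471803 : ℝ) < Real.log 2 := Real.log_two_gt_d9
  have h2' : Real.log 2 < 0.6931471808 := Real.log_two_lt_d9
  have h16 : Real.log 16 = 4 * Real.log 2 := by
    rw [show (16 : ℝ) = 2 ^ 4 by norm_num, Real.log_pow]; norm_num
  have hlog16 : Real.log 16 ≤ Real.log x := Real.log_le_log (by norm_num) hx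
  refine ⟨?_, by linarith, ?_, Real.log_sqrt hx0.le⟩
  · rw [show (4 : ℝ) = Real.sqrt 16 by rw [show (16 : ℝ) = 4 ^ 2 by norm_num, Real.sqrt_sq (by norm_num)]]
    exact Real.sqrt_le_sqrt hx
  · rw [Real.log_mul two_ne_zero hx0.ne']; linarith

/-- **Bookkeeping, I: the pointwise bound.** With `T = (q(|t|+2)x)²`, `L₂ = log(q · 2x · T) ≤ 4L`
(`L = log(q(|t|+2)x)`), the bound of `norm_twistedSum_add_zeroSums_le` at `X ≤ 2x`, `c ≥ 2` is
`≤ (12K + 6) log x + 32 K L` for `x ≥ 16` (`x L/T ≤ 1/4`, `|t| x L/T ≤ 1/2`). [folklore] -/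
theorem pointwiseBound_le {K q t x T : ℝ} (hK : 0 ≤ K) (hq : 2 ≤ q) (hx : 16 ≤ x)
    (hT : T = (q * (|t| + 2) * x) ^ 2) :
    (2 * K + 3) * Real.log (2 * x) + 2 * K * (2 * x / T) * Real.log (q * (2 * x) * T) ^ 2 +
        |t| * K * (4 * (2 * x) * Real.log (2 * x) / Real.sqrt (2 * T) +
          2 * x * Real.log (q * (2 * x) * T) ^ 2 / T) ≤
      12 * (K * Real.log x) + 6 * Real.log x + 32 * (K * Real.log (q * (|t| + 2) * x)) := by
  obtain ⟨hR64, h4x, htx, hT2, -, hsqrtT⟩ := T_facts (t := t) hq hx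
  obtain ⟨-, hℓ, hlog2x, -⟩ := log_facts hx
  have h2' : Real.log 2 < 0.6931471808 := Real.log_two_lt_d9
  have hx0 : 0 < x := by linarith
  have hq0 : 0 < q := by linarith
  have ht0 : 0 ≤ |t| := abs_nonneg t
  set ℓ := Real.log x with hℓdef
  set R := q * (|t| + 2) * x with hRdef
  have hR0 : 0 < R := by linarith
  set L := Real.log (q * (|t| + 2) * x) with hLdef
  have hLeq : L = Real.log q + Real.log (|t| + 2) + ℓ := by
    rw [hLdef, Real.log_mul (by positivity) hx0.ne', Real.log_mul hq0.ne' (by positivity)]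
  have hlogq : Real.log 2 ≤ Real.log q := Real.log_le_log two_pos hq
  have hlogt : Real.log 2 ≤ Real.log (|t| + 2) := Real.log_le_log two_pos (by linarith)
  have h2 : (0.6931471803 : ℝ) < Real.log 2 := Real.log_two_gt_d9
  have hL2 : 2 ≤ L := by linarith
  have hL0 : 0 ≤ L := by linarith
  have hLR : L ≤ R := by
    have := Real.log_le_sub_one_of_pos hR0; rw [← hRdef] at hLdef; rw [hLdef]; linarith
  have hT0 : 0 < T := by rw [hT]; positivity
  have hlogT : Real.log T = 2 * L := by rw [hT, Real.log_pow, hLdef, hRdef]; push_cast; ring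
  -- `L₂ ≤ 4L`
  set L₂ := Real.log (q * (2 * x) * T) with hL₂def
  have hL₂ : L₂ = Real.log q + Real.log (2 * x) + 2 * L := by
    rw [hL₂def, Real.log_mul (by positivity) hT0.ne', Real.log_mul hq0.ne' (by positivity), hlogT]
  have hL₂4 : L₂ ≤ 4 * L := by rw [hL₂]; linarith
  have hL₂0 : 0 ≤ L₂ := by rw [hL₂]; linarith [Real.log_nonneg (by linarith : (1 : ℝ) ≤ 2 * x)]
  have hL₂sq : L₂ ^ 2 ≤ 16 * L ^ 2 := by
    have := pow_le_pow_left₀ hL₂0 hL₂4 2; nlinarith [this]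
  -- the key ratios `x L/T ≤ 1/4`, `|t| x L/T ≤ 1/2`
  have hsqT : R * R = T := by rw [hT]; ring
  have hxLT : x * L / T ≤ 1 / 4 := by
    rw [div_le_iff₀ hT0]
    have h := mul_le_mul_of_nonneg_right h4x hR0.le
    calc x * L ≤ x * R := mul_le_mul_of_nonneg_left hLR hx0.le
      _ ≤ 1 / 4 * T := by rw [← hsqT]; linarith
  have htxLT : |t| * x * L / T ≤ 1 / 2 := by
    rw [div_le_iff₀ hT0]
    have h := mul_le_mul_of_nonneg_right htx hR0.le
    calc |t| * x * L ≤ |t| * x * R := mul_le_mul_of_nonneg_left hLR (by positivity)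
      _ ≤ 1 / 2 * T := by rw [← hsqT]; linarith
  -- the four pieces
  have p1 : (2 * K + 3) * Real.log (2 * x) ≤ 4 * (K * ℓ) + 6 * ℓ := by
    have := mul_le_mul_of_nonneg_left hlog2x (by positivity : 0 ≤ 2 * K + 3); linarith
  have p2 : 2 * K * (2 * x / T) * L₂ ^ 2 ≤ 16 * (K * L) := by
    have e : 2 * K * (2 * x / T) * L₂ ^ 2 = 4 * K * (x / T) * L₂ ^ 2 := by ring
    rw [e]
    calc 4 * K * (x / T) * L₂ ^ 2 ≤ 4 * K * (x / T) * (16 * L ^ 2) :=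
          mul_le_mul_of_nonneg_left hL₂sq (by positivity)
      _ = 64 * (K * L) * (x * L / T) := by ring
      _ ≤ 64 * (K * L) * (1 / 4) := mul_le_mul_of_nonneg_left hxLT (by positivity)
      _ = 16 * (K * L) := by ring
  have p3 : |t| * (4 * (2 * x) * Real.log (2 * x) / Real.sqrt (2 * T)) ≤ 8 * ℓ := by
    have hsq : R ≤ Real.sqrt (2 * T) := by
      rw [← hsqrtT, ← hT]; exact Real.sqrt_le_sqrt (by linarith)
    have hnum : 4 * (2 * x) * Real.log (2 * x) ≤ 16 * x * ℓ := by
      have := mul_le_mul_of_nonneg_left hlog2x (by positivity : 0 ≤ 8 * x); linarith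
    calc |t| * (4 * (2 * x) * Real.log (2 * x) / Real.sqrt (2 * T))
        ≤ |t| * (16 * x * ℓ / R) :=
          mul_le_mul_of_nonneg_left (div_le_div₀ (by positivity) hnum hR0 hsq) ht0
      _ = 16 * ℓ * (|t| * x / R) := by ring
      _ ≤ 16 * ℓ * (1 / 2) := by
          refine mul_le_mul_of_nonneg_left ?_ (by positivity)
          rw [div_le_iff₀ hR0]; linarith
      _ = 8 * ℓ := by ring
  have p4 : |t| * (2 * x * L₂ ^ 2 / T) ≤ 16 * L := by
    calc |t| * (2 * x * L₂ ^ 2 / T) ≤ |t| * (2 * x * (16 * L ^ 2) / T) := by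
          refine mul_le_mul_of_nonneg_left (div_le_div_of_nonneg_right ?_ hT0.le) ht0
          exact mul_le_mul_of_nonneg_left hL₂sq (by positivity)
      _ = 32 * L * (|t| * x * L / T) := by ring
      _ ≤ 32 * L * (1 / 2) := mul_le_mul_of_nonneg_left htxLT (by positivity)
      _ = 16 * L := by ring
  have e : |t| * K * (4 * (2 * x) * Real.log (2 * x) / Real.sqrt (2 * T) + 2 * x * L₂ ^ 2 / T) =
      K * (|t| * (4 * (2 * x) * Real.log (2 * x) / Real.sqrt (2 * T)) +
        |t| * (2 * x * L₂ ^ 2 / T)) := by ring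
  rw [e]
  have p34 := mul_le_mul_of_nonneg_left (add_le_add p3 p4) hK
  linarith

/-- **Bookkeeping, II: the window factor.** `log q + log(2|t| + T + 5) ≤ 4 log(q(|t|+2)x)` for
`T = (q(|t|+2)x)²`, `q ≥ 2`, `x ≥ 16`. [folklore] -/
theorem windowLog_le {q t x T : ℝ} (hq : 2 ≤ q) (hx : 16 ≤ x) (hT : T = (q * (|t| + 2) * x) ^ 2) :
    Real.log q + Real.log (2 * |t| + T + 5) ≤ 4 * Real.log (q * (|t| + 2) * x) := by
  obtain ⟨hR64, -, -, hT2, hT2t, -⟩ := T_facts (t := t) hq hx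
  obtain ⟨-, hℓ, -, -⟩ := log_facts hx
  have h2' : Real.log 2 < 0.6931471808 := Real.log_two_lt_d9
  have hx0 : 0 < x := by linarith
  have hq0 : 0 < q := by linarith
  have hT0 : 0 < T := by rw [hT]; positivity
  have hLeq : Real.log (q * (|t| + 2) * x) = Real.log q + Real.log (|t| + 2) + Real.log x := by
    rw [Real.log_mul (by positivity) hx0.ne', Real.log_mul hq0.ne' (by positivity)]
  have hlogt : Real.log 2 ≤ Real.log (|t| + 2) := Real.log_le_log two_pos (by linarith [abs_nonneg t])
  have hlogq : Real.log 2 ≤ Real.log q := Real.log_le_log two_pos hq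
  have h2 : (0.6931471803 : ℝ) < Real.log 2 := Real.log_two_gt_d9
  have hlogT : Real.log T = 2 * Real.log (q * (|t| + 2) * x) := by rw [hT, Real.log_pow]; push_cast; ring
  have h1 : Real.log (2 * |t| + T + 5) ≤ Real.log (2 * T) :=
    Real.log_le_log (by positivity) (by rw [hT]; linarith)
  rw [Real.log_mul two_ne_zero hT0.ne', hlogT] at h1
  linarith

/-- **Bookkeeping, III: the total.** The simplified pointwise bound plus the short-interval term
`(√x + 1) log 2x`, the two averaged zero sums (window factor `ℒ ≤ 4L`) and `log 2` is
`≤ (6K + 73C₂ + 50) √x log x log(q(|t|+2)x)` for `x ≥ 16`. [folklore] -/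
theorem norm_twistedPsi_arith {K C₂ q t x ℒ nS nS₃ nc nX : ℝ} (hK : 0 ≤ K) (hC : 0 ≤ C₂)
    (hq : 2 ≤ q) (hx : 16 ≤ x) (hℒ : ℒ ≤ 4 * Real.log (q * (|t| + 2) * x))
    (hS : nS ≤ nS₃ + Real.log 2)
    (h₃ : nS₃ ≤ (12 * (K * Real.log x) + 6 * Real.log x + 32 * (K * Real.log (q * (|t| + 2) * x))) +
        (Real.sqrt x + 1) * Real.log (2 * x) + nc + nX)
    (hnc : nc ≤ 31 * (C₂ * ℒ * (1 + Real.log (1 + 1 / 1))))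
    (hnX : nX ≤ 4 * Real.sqrt 2 * Real.sqrt x * (C₂ * ℒ * (1 + Real.log (1 + 1 / (Real.sqrt x)⁻¹)))) :
    nS ≤ (6 * K + 73 * C₂ + 50) * Real.sqrt x * Real.log x * Real.log (q * (|t| + 2) * x) := by
  obtain ⟨hs4, hℓ, hlog2x, hlogs⟩ := log_facts hx
  have h2 : (0.6931471803 : ℝ) < Real.log 2 := Real.log_two_gt_d9
  have h2' : Real.log 2 < 0.6931471808 := Real.log_two_lt_d9
  have hx0 : 0 < x := by linarith
  have hq0 : 0 < q := by linarith
  set s := Real.sqrt x with hs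
  set ℓ := Real.log x with hℓdef
  set L := Real.log (q * (|t| + 2) * x) with hLdef
  have hLeq : L = Real.log q + Real.log (|t| + 2) + ℓ := by
    rw [hLdef, Real.log_mul (by positivity) hx0.ne', Real.log_mul hq0.ne' (by positivity)]
  have hlogq : Real.log 2 ≤ Real.log q := Real.log_le_log two_pos hq
  have hlogt : Real.log 2 ≤ Real.log (|t| + 2) := Real.log_le_log two_pos (by linarith [abs_nonneg t])
  have hL2 : 2 ≤ L := by linarith
  have hL0 : 0 ≤ L := by linarith
  have hℓ0 : 0 ≤ ℓ := by linarith only [hℓ]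
  have hs1 : 1 ≤ s := le_trans (by norm_num) hs4
  have hs0 : 0 < s := by linarith only [hs4]
  -- the short interval
  have p5 : (s + 1) * Real.log (2 * x) ≤ 4 * (s * ℓ) := by
    have h0 : 0 ≤ Real.log (2 * x) := Real.log_nonneg (by linarith only [hx])
    have := mul_le_mul (by linarith only [hs1] : s + 1 ≤ 2 * s) hlog2x h0 (by positivity)
    linarith only [this]
  -- the averaged zero sums
  have pc : nc ≤ 211 * (C₂ * L) := by
    refine hnc.trans ?_
    have h17 : 1 + Real.log (1 + 1 / 1) ≤ 1.7 := by norm_num; linarith only [h2']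
    have h0 : 0 ≤ 1 + Real.log (1 + 1 / 1) := by
      norm_num; linarith only [Real.log_nonneg (one_le_two : (1 : ℝ) ≤ 2)]
    calc 31 * (C₂ * ℒ * (1 + Real.log (1 + 1 / 1))) ≤ 31 * (C₂ * (4 * L) * 1.7) := by
          refine mul_le_mul_of_nonneg_left ?_ (by norm_num)
          exact mul_le_mul (mul_le_mul_of_nonneg_left hℒ hC) h17 h0 (by positivity)
      _ = 210.8 * (C₂ * L) := by ring
      _ ≤ 211 * (C₂ * L) := by linarith only [mul_nonneg hC hL0]
  have pX : nX ≤ 30 * (C₂ * (s * ℓ * L)) := by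
    refine hnX.trans ?_
    have hinv : 1 / s⁻¹ = s := by rw [one_div, inv_inv]
    rw [hinv]
    have hls : Real.log (1 + s) ≤ Real.log 2 + ℓ / 2 := by
      rw [← hlogs, ← Real.log_mul two_ne_zero hs0.ne']
      exact Real.log_le_log (by linarith only [hs0]) (by linarith only [hs1])
    have h54 : 1 + Real.log (1 + s) ≤ 5 / 4 * ℓ := by linarith only [hls, h2', hℓ]
    have h0 : 0 ≤ 1 + Real.log (1 + s) := by
      linarith only [Real.log_nonneg (by linarith only [hs0] : (1 : ℝ) ≤ 1 + s)]
    have hsq2 : Real.sqrt 2 ≤ 3 / 2 := by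
      rw [Real.sqrt_le_left (by norm_num)]; norm_num
    calc 4 * Real.sqrt 2 * s * (C₂ * ℒ * (1 + Real.log (1 + s)))
        ≤ 4 * Real.sqrt 2 * s * (C₂ * (4 * L) * (5 / 4 * ℓ)) :=
          mul_le_mul_of_nonneg_left (mul_le_mul (mul_le_mul_of_nonneg_left hℒ hC) h54 h0 (by positivity))
            (by positivity)
      _ ≤ 4 * (3 / 2) * s * (C₂ * (4 * L) * (5 / 4 * ℓ)) :=
          mul_le_mul_of_nonneg_right (mul_le_mul_of_nonneg_right (by linarith only [hsq2]) hs0.le)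
            (by positivity)
      _ = 30 * (C₂ * (s * ℓ * L)) := by ring
  -- conversions to `M = s ℓ L`
  set M := s * ℓ * L with hM
  have hsL : 8 ≤ s * L := by nlinarith [mul_nonneg (sub_nonneg.2 hs4) (sub_nonneg.2 hL2)]
  have hsℓ8 : 8 ≤ s * ℓ := by
    nlinarith [mul_nonneg (sub_nonneg.2 hs4) (sub_nonneg.2 (by linarith only [hℓ] : (2 : ℝ) ≤ ℓ))]
  have hℓM : 8 * ℓ ≤ M := by
    have := mul_le_mul_of_nonneg_left hsL hℓ0; rw [hM]; linarith only [this]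
  have hLM : 8 * L ≤ M := by
    have := mul_le_mul_of_nonneg_left hsℓ8 hL0; rw [hM]; linarith only [this]
  have hsℓM : 2 * (s * ℓ) ≤ M := by
    have := mul_le_mul_of_nonneg_left hL2 (by positivity : 0 ≤ s * ℓ); rw [hM]; linarith only [this]
  have h1M : 16 ≤ M := by linarith only [hℓM, hℓ]
  have hKℓ : 8 * (K * ℓ) ≤ K * M := by have := mul_le_mul_of_nonneg_left hℓM hK; linarith only [this]
  have hKL : 8 * (K * L) ≤ K * M := by have := mul_le_mul_of_nonneg_left hLM hK; linarith only [this]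
  have hCL : 8 * (C₂ * L) ≤ C₂ * M := by have := mul_le_mul_of_nonneg_left hLM hC; linarith only [this]
  have hgoal : (6 * K + 73 * C₂ + 50) * s * ℓ * Real.log (q * (|t| + 2) * x) =
      6 * (K * M) + 73 * (C₂ * M) + 50 * M := by rw [hM, hLdef]; ring
  rw [hgoal]
  have hKM : 0 ≤ K * M := by positivity
  have hCM : 0 ≤ C₂ * M := by positivity
  linarith only [hS, h₃, p5, pc, pX, hℓM, hLM, hsℓM, h1M, hKℓ, hKL, hCL, hKM, hCM, h2', hℓ0, hK, hC]

end GRHTwistedPrimeSum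

end Literature.NumberTheory.LFunctions
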